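import Mathlib
import Literature.Analysis.FluidPDE.PoincareBall
import Literature.Analysis.FluidPDE.LocalLerayPressureRenormalisation
import Summits.NavierStokesRegularity.NavierStokesRegularity.Theorems.EulerZoomLiouvillePowerGaugeEulerLiouvilleGalileanFictitiousForceTools
import Summits.NavierStokesRegularity.NavierStokesRegularity.Theorems.EulerZoomLiouvillePowerGaugeEulerLiouvilleGalileanAffineLowerBound
import Summits.NavierStokesRegularity.NavierStokesRegularity.Theorems.EulerZoomLiouvillePowerGaugeEulerLiouvilleExtinctIdentityTools
import HarnessLib

/-!
# FICTITIOUS FORCES ARE CONSTANT UNDER THE PRESSURE GAUGE — F3's first lemma (β) of line `galilean-frames`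
# (crux `EulerZoomLiouville.PowerGaugeEulerLiouville` = stmt-NavierStokesRegularity-19832; ideator ns-idea-11 g6, critic V48 P2; width seat ns-ezl-w1 g4)

Route №10 `EulerZoomLiouville` (NavierStokesRegularity).  Lever (L3) of the line: for a WANDERING self-similar member the weak Euler equation
forces a co-moving similarity pressure `p(τ,y) = (T−τ)^{2γ−2}[P̄(Y) − ⟪b(τ), Y⟫ + c₁(τ)]`, `Y = (T−τ)^{−γ}(y − ξ(τ))`, whose linear part
`−⟪b(τ), Y⟫` is the fictitious force of the accelerating centre.  The pressure gauge `∫∫_{Q_a}|p|^{3/2} ≤ c a^{2−2ρ}` sees it: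

* **`fictitiousForceConstant`** = `Sig.lemma_fictitiousForceConstant` of `Cruxes/PowerGaugeEulerLiouville/Lines/galilean_frames.lean` (BODIES VERBATIM):
  under the class hypotheses, `T₁ ≤ 0`, `T₁ ≤ T`, `ξ ∈ C²`, `b` measurable and the displayed form of `p` below `T₁`, the force coefficient
  `b` is a.e. CONSTANT on `(−∞, T₁)`.

Proof: if not, `b` takes values in two balls `2r` apart on time sets `A₁, A₂` of positive measure inside a bounded window
(`GalileanFrames.exists_two_essential_balls`); Chebyshev in time (`exists_slice_le_div`) gives, for every large `a`, slices `τᵢ ∈ Aᵢ` with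
`∫_{B_a}|p(τᵢ)|^{3/2} ≤ c a^{2−2ρ}/|Aᵢ|`; the substitution `Y = s(y − ξ)` turns them into `∫_{B_L}|P̄ − ⟪b(τᵢ),·⟫ + c₁(τᵢ)|^{3/2} ≲ a^{2−2ρ}` with
`L ≍ a`; subtracting (convexity of `t^{3/2}`) and the two-point affine lower bound (α) `GalileanFrames.affineL32LowerBound` give
`κ (2r)^{3/2} L^{9/2} ≲ a^{2−2ρ}`, absurd for large `a` since `5/2 + 2ρ > 0`.

HONEST LABEL: first lemma of F3 (not a stub of the composition).  WHAT THIS IS NOT: not NS, not E — `--supports` stmt-19832; 19832 OPEN.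
[folklore; CaffarelliKohnNirenberg1982 §2 (the `D`-gauge)]
-/

noncomputable section

-- flat `Theorems/<Route><Decl>…` files of one crux share the namespace of the crux (tree convention)
set_option linter.dupNamespace false

open MeasureTheory Set Filter Topology Metric Function InnerProductSpace TopologicalSpace
open scoped RealInnerProductSpace NNReal ENNReal

namespace Summit.NavierStokesRegularity.NavierStokesRegularity.Theorems.PowerGaugeEulerLiouville.GalileanFrames

open Literature.Analysis Literature.Analysis.FluidPDE

/-- **FICTITIOUS FORCES ARE CONSTANT UNDER THE PRESSURE GAUGE** (`Sig.lemma_fictitiousForceConstant` of `Lines/galilean_frames.lean`, bodies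
verbatim).  If a member of Seregin's power-gauged ancient Euler class has, below `T₁ ≤ min(0,T)`, a pressure of the co-moving similarity form
`p(τ,y) = (T−τ)^{2γ−2}[P̄(Y) − ⟪b(τ), Y⟫ + c₁(τ)]`, `Y = (T−τ)^{−γ}(y − ξ(τ))`, `γ = 1/(2+ρ)`, with one profile pressure `P̄`, a measurable
force coefficient `b` and any `c₁`, then `b` is a.e. constant on `(−∞, T₁)`: two essential values would produce, by the two-point
affine `L^{3/2}` lower bound, slices with `∫_{B_a}|p|^{3/2} ≳ a^{9/2}` against the `D`-gauge `≲ a^{2−2ρ}`. [folklore] -/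
theorem fictitiousForceConstant :
    ∀ ρ : ℝ, 0 < ρ → ρ ≤ 1 / 2 →
      ∀ (u : ℝ → EuclideanSpace ℝ (Fin 3) → EuclideanSpace ℝ (Fin 3)) (p : ℝ → EuclideanSpace ℝ (Fin 3) → ℝ)
        (H : ℝ → EuclideanSpace ℝ (Fin 3) → EuclideanSpace ℝ (Fin 3) →L[ℝ] EuclideanSpace ℝ (Fin 3)) (c : ℝ≥0)
        (T T₁ : ℝ) (ξ : ℝ → EuclideanSpace ℝ (Fin 3)) (Pbar : EuclideanSpace ℝ (Fin 3) → ℝ)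
        (b : ℝ → EuclideanSpace ℝ (Fin 3)) (c₁ : ℝ → ℝ),
      (IsSuitableWeakSolutionOn (slab (EuclideanSpace ℝ (Fin 3)) (Set.Iio 0) isOpen_Iio) 0 0 u p ∧
        HasWeakSpatialGradientOn (slab (EuclideanSpace ℝ (Fin 3)) (Set.Iio 0) isOpen_Iio) u H ∧
        (∀ a : ℝ, 0 < a →
          ENNReal.ofReal (a ^ (2 * ρ)) * cknA a (0 : ℝ × EuclideanSpace ℝ (Fin 3)) u +
              ENNReal.ofReal (a ^ ρ) * cknE a (0 : ℝ × EuclideanSpace ℝ (Fin 3)) H +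
            ENNReal.ofReal (a ^ (2 * ρ)) * cknD a (0 : ℝ × EuclideanSpace ℝ (Fin 3)) p ≤ (c : ℝ≥0∞))) →
      T₁ ≤ 0 → T₁ ≤ T → ContDiff ℝ 2 ξ → Measurable b →
      (∀ τ : ℝ, τ < T₁ → p τ = fun y =>
          (T - τ) ^ (2 * (1 / (2 + ρ)) - 2) *
            (Pbar ((T - τ) ^ (-(1 / (2 + ρ))) • (y - ξ τ)) -
              ⟪b τ, (T - τ) ^ (-(1 / (2 + ρ))) • (y - ξ τ)⟫ + c₁ τ)) →
      ∃ b₀ : EuclideanSpace ℝ (Fin 3), ∀ᵐ τ ∂(volume.restrict (Set.Iio T₁)), b τ = b₀ := by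
  intro ρ hρ hρh u p H c T T₁ ξ Pbar b c₁ hcls hT₁ hTT₁ hξ hbm hp
  obtain ⟨hsw, hH, hgauge⟩ := hcls
  by_contra hnc
  have hD : ∀ a : ℝ, 0 < a →
      ENNReal.ofReal (a ^ (2 * ρ)) * cknD a (0 : ℝ × EuclideanSpace ℝ (Fin 3)) p ≤ (c : ℝ≥0∞) :=
    fun a ha => le_trans le_add_self (hgauge a ha)
  set γ : ℝ := 1 / (2 + ρ) with hγ
  have hγ0 : 0 < γ := by rw [hγ]; positivity
  -- ### two essential values of `b`
  have hS0 : volume (Iio T₁) ≠ 0 := by rw [Real.volume_Iio]; exact ENNReal.top_ne_zero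
  obtain ⟨z₁, z₂, r, hr, hdist, hA₁', hA₂'⟩ := exists_two_essential_balls hbm hS0 hnc
  -- ### a.e. slices of `p` are a.e.-strongly measurable
  have hpm : AEStronglyMeasurable (uncurry p)
      (volume.restrict (Iio (0 : ℝ) ×ˢ (univ : Set (EuclideanSpace ℝ (Fin 3))))) := by
    simpa [slab] using hsw.distributional.2.2.1.aestronglyMeasurable
  set G : Set ℝ := {τ | τ < 0 → AEStronglyMeasurable (p τ) volume} with hGdef
  have hGc : volume Gᶜ = 0 := by
    have h := ExtinctTrace.ae_aestronglyMeasurable_slice hpm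
    rw [ae_iff] at h
    simpa [hGdef, compl_setOf] using h
  -- ### a bounded window carrying both value sets in positive measure
  have hsub₁ : (Iio T₁ ∩ b ⁻¹' ball z₁ r) ∩ G ⊆ Iio T₁ := fun τ hτ => hτ.1.1
  have hsub₂ : (Iio T₁ ∩ b ⁻¹' ball z₂ r) ∩ G ⊆ Iio T₁ := fun τ hτ => hτ.1.1
  obtain ⟨K₁, hK₁⟩ := exists_window_inter_ne_zero (measure_inter_ne_zero_of_null_compl hA₁' hGc) hsub₁
  obtain ⟨K₂, hK₂⟩ := exists_window_inter_ne_zero (measure_inter_ne_zero_of_null_compl hA₂' hGc) hsub₂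
  obtain ⟨K, hKdef⟩ : ∃ K : ℝ, K = (max K₁ K₂ : ℕ) + 1 := ⟨_, rfl⟩
  have hK1 : 1 ≤ K := by rw [hKdef]; linarith [(Nat.cast_nonneg (max K₁ K₂) : (0 : ℝ) ≤ _)]
  have hK0 : 0 < K := by linarith
  set W : Set ℝ := Ioo (T₁ - K) (T₁ - 1 / K) with hWdef
  have hWmono : ∀ {K' : ℕ}, K' ≤ max K₁ K₂ →
      Ioo (T₁ - ((K' : ℝ) + 1)) (T₁ - 1 / ((K' : ℝ) + 1)) ⊆ W := by
    intro K' hK'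
    have h1 : (K' : ℝ) + 1 ≤ K := by rw [hKdef]; exact_mod_cast Nat.succ_le_succ hK'
    refine Ioo_subset_Ioo (by linarith) ?_
    have : 1 / K ≤ 1 / ((K' : ℝ) + 1) := one_div_le_one_div_of_le (by positivity) h1
    linarith
  set A₁ : Set ℝ := (Iio T₁ ∩ b ⁻¹' ball z₁ r) ∩ G ∩ W with hA₁def
  set A₂ : Set ℝ := (Iio T₁ ∩ b ⁻¹' ball z₂ r) ∩ G ∩ W with hA₂def
  have hA₁0 : volume A₁ ≠ 0 := by
    intro h0
    apply hK₁
    refine measure_mono_null (fun τ hτ => ?_) h0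
    exact ⟨hτ.1, hWmono (le_max_left _ _) hτ.2⟩
  have hA₂0 : volume A₂ ≠ 0 := by
    intro h0
    apply hK₂
    refine measure_mono_null (fun τ hτ => ?_) h0
    exact ⟨hτ.1, hWmono (le_max_right _ _) hτ.2⟩
  have hAW : ∀ {i : Set ℝ}, i = A₁ ∨ i = A₂ → i ⊆ W := by
    rintro i (rfl | rfl) <;> exact fun τ hτ => hτ.2
  have hWfin : volume W < ⊤ := by rw [hWdef, Real.volume_Ioo]; exact ENNReal.ofReal_lt_top
  have hA₁fin : volume A₁ ≠ ⊤ := (lt_of_le_of_lt (measure_mono (hAW (Or.inl rfl))) hWfin).ne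
  have hA₂fin : volume A₂ ≠ ⊤ := (lt_of_le_of_lt (measure_mono (hAW (Or.inr rfl))) hWfin).ne
  -- ### uniform constants on the window: `d = T − τ ∈ [1/K, K + (T − T₁)]`
  obtain ⟨dlo, hdlo⟩ : ∃ dlo : ℝ, dlo = 1 / K := ⟨_, rfl⟩
  obtain ⟨dhi, hdhi⟩ : ∃ dhi : ℝ, dhi = K + (T - T₁) := ⟨_, rfl⟩
  have hdlo0 : 0 < dlo := by rw [hdlo]; positivity
  have hdhi0 : 0 < dhi := by rw [hdhi]; linarith
  have hwin : ∀ τ ∈ W, dlo ≤ T - τ ∧ T - τ ≤ dhi ∧ τ < T₁ ∧ τ < 0 := by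
    intro τ hτ
    rw [hWdef, mem_Ioo] at hτ
    have h1K : 0 < 1 / K := by positivity
    refine ⟨by rw [hdlo]; linarith, by rw [hdhi]; linarith, by linarith, by linarith⟩
  -- `s(τ) = (T−τ)^{−γ} ≤ shi`, `s(τ) ≥ slo`, `m(τ) = (T−τ)^{2γ−2} ≥ mlo`
  obtain ⟨shi, hshi⟩ : ∃ shi : ℝ, shi = dlo ^ (-γ) := ⟨_, rfl⟩
  obtain ⟨slo, hslo⟩ : ∃ slo : ℝ, slo = dhi ^ (-γ) := ⟨_, rfl⟩
  obtain ⟨mlo, hmlo⟩ : ∃ mlo : ℝ, mlo = dhi ^ (2 * γ - 2) := ⟨_, rfl⟩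
  have hshi0 : 0 < shi := by rw [hshi]; exact Real.rpow_pos_of_pos hdlo0 _
  have hslo0 : 0 < slo := by rw [hslo]; exact Real.rpow_pos_of_pos hdhi0 _
  have hmlo0 : 0 < mlo := by rw [hmlo]; exact Real.rpow_pos_of_pos hdhi0 _
  have hsm : ∀ τ ∈ W, slo ≤ (T - τ) ^ (-γ) ∧ (T - τ) ^ (-γ) ≤ shi ∧ mlo ≤ (T - τ) ^ (2 * γ - 2) := by
    intro τ hτ
    obtain ⟨h1, h2, -, -⟩ := hwin τ hτ
    have hd0 : 0 < T - τ := hdlo0.trans_le h1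
    refine ⟨?_, ?_, ?_⟩
    · rw [hslo]; exact Real.rpow_le_rpow_of_nonpos hd0 h2 (by linarith)
    · rw [hshi]; exact Real.rpow_le_rpow_of_nonpos hdlo0 h1 (by linarith)
    · rw [hmlo]
      refine Real.rpow_le_rpow_of_nonpos hd0 h2 ?_
      have : γ < 1 := by rw [hγ, div_lt_one (by linarith)]; linarith
      linarith
  -- bound on the path on the closed window
  obtain ⟨Ξ, hΞ⟩ : ∃ Ξ : ℝ, ∀ τ ∈ Icc (T₁ - K) T₁, ‖ξ τ‖ ≤ Ξ :=
    isCompact_Icc.exists_bound_of_continuousOn (hξ.continuous.continuousOn)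
  have hΞ0 : 0 ≤ Ξ := (norm_nonneg _).trans (hΞ T₁ ⟨by linarith, le_rfl⟩)
  have hξW : ∀ τ ∈ W, ‖ξ τ‖ ≤ Ξ := fun τ hτ => by
    rw [hWdef, mem_Ioo] at hτ
    exact hΞ τ ⟨hτ.1.le, by linarith [show 0 < 1 / K from by positivity]⟩
  -- ### the two-point affine lower bound (α) and the choice of the scale `a`
  obtain ⟨κ, hκ, hαb⟩ := affineL32LowerBound
  obtain ⟨Λ, hΛdef⟩ : ∃ Λ : ℝ, Λ = ((volume A₁)⁻¹ + (volume A₂)⁻¹).toReal := ⟨_, rfl⟩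
  have hΛtop : (volume A₁)⁻¹ + (volume A₂)⁻¹ ≠ ⊤ :=
    ENNReal.add_ne_top.2 ⟨ENNReal.inv_ne_top.2 hA₁0, ENNReal.inv_ne_top.2 hA₂0⟩
  have hΛ : ((volume A₁)⁻¹ + (volume A₂)⁻¹) = ENNReal.ofReal Λ := by rw [hΛdef, ENNReal.ofReal_toReal hΛtop]
  have hΛ0 : 0 ≤ Λ := by rw [hΛdef]; exact ENNReal.toReal_nonneg
  -- the constants of the final inequality `lhsC · a^{9/2} ≤ rhsC · a^{2−2ρ}`
  obtain ⟨S₀, hS₀⟩ : ∃ S₀ : ℝ, S₀ = shi ^ 3 * mlo ^ (-(3 / 2 : ℝ)) := ⟨_, rfl⟩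
  have hS₀0 : 0 < S₀ := by rw [hS₀]; exact mul_pos (pow_pos hshi0 3) (Real.rpow_pos_of_pos hmlo0 _)
  obtain ⟨lhsC, hlhsC⟩ : ∃ lhsC : ℝ, lhsC = κ * (2 * r) ^ (3 / 2 : ℝ) * (slo / 2) ^ (9 / 2 : ℝ) := ⟨_, rfl⟩
  have hlhsC0 : 0 < lhsC := by rw [hlhsC]; positivity
  obtain ⟨rhsC, hrhsC⟩ : ∃ rhsC : ℝ, rhsC = (2 : ℝ) ^ (1 / 2 : ℝ) * S₀ * (c : ℝ) * Λ := ⟨_, rfl⟩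
  have hrhsC0 : 0 ≤ rhsC := by rw [hrhsC]; positivity
  -- a large scale: `a ≥ 1`, `a² ≥ K + |T₁|`, `a ≥ 2Ξ`, and `rhsC · a^{2−2ρ} < lhsC · a^{9/2}`
  obtain ⟨a, ha1, ha2, ha3, ha4⟩ : ∃ a : ℝ, 1 ≤ a ∧ K + |T₁| ≤ a ^ 2 ∧ 2 * Ξ ≤ a ∧
      rhsC * a ^ (2 - 2 * ρ) < lhsC * a ^ (9 / 2 : ℝ) := by
    have e1 : ∀ᶠ a : ℝ in atTop, 1 ≤ a := eventually_ge_atTop 1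
    have e2 : ∀ᶠ a : ℝ in atTop, K + |T₁| ≤ a ^ 2 := by
      refine (eventually_ge_atTop (max (K + |T₁|) 1)).mono fun a ha => ?_
      have ha1 : 1 ≤ a := (le_max_right _ _).trans ha
      nlinarith [(le_max_left _ _).trans ha]
    have e3 : ∀ᶠ a : ℝ in atTop, 2 * Ξ ≤ a := eventually_ge_atTop _
    have e4 : ∀ᶠ a : ℝ in atTop, rhsC * a ^ (2 - 2 * ρ) < lhsC * a ^ (9 / 2 : ℝ) := by
      -- `a^{9/2} / a^{2−2ρ} = a^{5/2+2ρ} → ∞`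
      have hq : 0 < 5 / 2 + 2 * ρ := by linarith
      have ht : Tendsto (fun a : ℝ => a ^ (5 / 2 + 2 * ρ)) atTop atTop := tendsto_rpow_atTop hq
      refine ((ht.eventually_gt_atTop (rhsC / lhsC)).and (eventually_gt_atTop 0)).mono fun a ⟨ha, ha0⟩ => ?_
      have hsplit : a ^ (9 / 2 : ℝ) = a ^ (2 - 2 * ρ) * a ^ (5 / 2 + 2 * ρ) := by
        rw [← Real.rpow_add ha0]; norm_num
      rw [hsplit, div_lt_iff₀ hlhsC0] at *
      have hpos : 0 < a ^ (2 - 2 * ρ) := Real.rpow_pos_of_pos ha0 _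
      nlinarith [mul_lt_mul_of_pos_left ha hpos]
    exact (e1.and (e2.and (e3.and e4))).exists.imp fun a h => ⟨h.1, h.2.1, h.2.2.1, h.2.2.2⟩
  have ha0 : 0 < a := by linarith
  -- ### the slices at scale `a`
  have hWQ : W ⊆ Ioo (-(a ^ 2)) 0 := fun τ hτ => by
    obtain ⟨-, -, h3, h4⟩ := hwin τ hτ
    rw [hWdef, mem_Ioo] at hτ
    exact ⟨by linarith [neg_abs_le T₁], h4⟩
  have hpmQ : AEStronglyMeasurable (uncurry p)
      (volume.restrict (Ioo (-(a ^ 2)) 0 ×ˢ ball (0 : EuclideanSpace ℝ (Fin 3)) a)) :=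
    hpm.mono_measure (Measure.restrict_mono (prod_mono (fun t ht => ht.2) (subset_univ _)) le_rfl)
  have htot := setLIntegral_cylinder_enorm_rpow_le_of_gaugeD hD ha0
  obtain ⟨τ₁, hτ₁A, hτ₁⟩ := exists_slice_le_div hA₁0 ((hAW (Or.inl rfl)).trans hWQ) hpmQ
  obtain ⟨τ₂, hτ₂A, hτ₂⟩ := exists_slice_le_div hA₂0 ((hAW (Or.inr rfl)).trans hWQ) hpmQ
  -- ### the profile functions `f_i(Y) = P̄(Y) − ⟪b τᵢ, Y⟫ + c₁ τᵢ` and the substitution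
  obtain ⟨L, hLdef⟩ : ∃ L : ℝ, L = slo / 2 * a := ⟨_, rfl⟩
  have hL0 : 0 < L := by rw [hLdef]; positivity
  -- generic slice computation (the two lemmas above)
  have hslice : ∀ τ ∈ W, AEStronglyMeasurable (p τ) volume →
      (∫⁻ Y in ball (0 : EuclideanSpace ℝ (Fin 3)) L,
          ‖Pbar Y - ⟪b τ, Y⟫ + c₁ τ‖ₑ ^ (3 / 2 : ℝ)) ≤
        ENNReal.ofReal S₀ * ∫⁻ y in ball (0 : EuclideanSpace ℝ (Fin 3)) a, ‖p τ y‖ₑ ^ (3 / 2 : ℝ) ∧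
      AEMeasurable (fun Y => ‖Pbar Y - ⟪b τ, Y⟫ + c₁ τ‖ₑ ^ (3 / 2 : ℝ)) volume := by
    intro τ hτW hpτ
    obtain ⟨hd1, hd2, hτT₁, hτ0⟩ := hwin τ hτW
    have hd0 : 0 < T - τ := hdlo0.trans_le hd1
    obtain ⟨hslo, hsshi, hmmlo⟩ := hsm τ hτW
    have hs0 : 0 < (T - τ) ^ (-γ) := Real.rpow_pos_of_pos hd0 _
    have hm0 : 0 < (T - τ) ^ (2 * γ - 2) := Real.rpow_pos_of_pos hd0 _
    have hq : ∀ y, p τ y = (T - τ) ^ (2 * γ - 2) *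
        (Pbar ((T - τ) ^ (-γ) • (y - ξ τ)) - ⟪b τ, (T - τ) ^ (-γ) • (y - ξ τ)⟫ + c₁ τ) := fun y => by
      rw [hp τ hτT₁]
    have hLs : L / (T - τ) ^ (-γ) + ‖ξ τ‖ ≤ a := by
      have h1 : L / (T - τ) ^ (-γ) ≤ L / slo := div_le_div_of_nonneg_left hL0.le hslo0 hslo
      have h2 : L / slo = a / 2 := by rw [hLdef]; field_simp
      have h3 := hξW τ hτW
      rw [h2] at h1
      calc L / (T - τ) ^ (-γ) + ‖ξ τ‖ ≤ a / 2 + Ξ := add_le_add h1 h3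
        _ ≤ a := by
            have : Ξ ≤ a / 2 := by
              have := ha3; exact (by linarith : Ξ ≤ a / 2)
            linarith
    refine ⟨(setLIntegral_profile_le_of_slice hm0 hs0 hLs hq).trans (mul_le_mul' (ENNReal.ofReal_le_ofReal ?_) le_rfl),
      aemeasurable_profile_of_slice hm0 hs0 hpτ hq⟩
    -- `s³ m^{−3/2} ≤ shi³ mlo^{−3/2} = S₀`
    rw [hS₀]
    have h1 : ((T - τ) ^ (-γ)) ^ 3 ≤ shi ^ 3 := pow_le_pow_left₀ hs0.le hsshi 3
    have h2 : ((T - τ) ^ (2 * γ - 2)) ^ (-(3 / 2 : ℝ)) ≤ mlo ^ (-(3 / 2 : ℝ)) :=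
      Real.rpow_le_rpow_of_nonpos hmlo0 hmmlo (by norm_num)
    exact mul_le_mul h1 h2 (Real.rpow_nonneg hm0.le _) (pow_nonneg hshi0.le 3)
  -- ### apply to the two slices
  have hτ₁W : τ₁ ∈ W := hτ₁A.2
  have hτ₂W : τ₂ ∈ W := hτ₂A.2
  have hpτ₁ : AEStronglyMeasurable (p τ₁) volume := hτ₁A.1.2 (hwin τ₁ hτ₁W).2.2.2
  have hpτ₂ : AEStronglyMeasurable (p τ₂) volume := hτ₂A.1.2 (hwin τ₂ hτ₂W).2.2.2
  obtain ⟨hJ₁, hf₁m⟩ := hslice τ₁ hτ₁W hpτ₁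
  obtain ⟨hJ₂, -⟩ := hslice τ₂ hτ₂W hpτ₂
  -- the two values are `≥ 2r` apart
  have hb₁ : b τ₁ ∈ ball z₁ r := hτ₁A.1.1.2
  have hb₂ : b τ₂ ∈ ball z₂ r := hτ₂A.1.1.2
  have hβ : 2 * r ≤ ‖b τ₁ - b τ₂‖ := by
    rw [mem_ball] at hb₁ hb₂
    have := dist_triangle4 z₂ (b τ₂) (b τ₁) z₁
    rw [hdist, dist_comm z₂ (b τ₂), dist_eq_norm (b τ₂) (b τ₁), norm_sub_rev] at this
    linarith
  -- (α) in `ℝ≥0∞` form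
  set β : EuclideanSpace ℝ (Fin 3) := b τ₁ - b τ₂ with hβdef
  set cc : ℝ := c₁ τ₁ - c₁ τ₂ with hccdef
  have hαR := hαb β cc L hL0
  have hcont : Continuous fun Y : EuclideanSpace ℝ (Fin 3) => |⟪β, Y⟫ - cc| ^ (3 / 2 : ℝ) :=
    ((continuous_const.inner continuous_id).sub continuous_const).abs.rpow_const fun _ => Or.inr (by norm_num)
  have hintg : IntegrableOn (fun Y : EuclideanSpace ℝ (Fin 3) => |⟪β, Y⟫ - cc| ^ (3 / 2 : ℝ))
      (ball (0 : EuclideanSpace ℝ (Fin 3)) L) :=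
    (hcont.continuousOn.integrableOn_compact (isCompact_closedBall _ _)).mono_set ball_subset_closedBall
  have hαE : ENNReal.ofReal (κ * ‖β‖ ^ (3 / 2 : ℝ) * L ^ (9 / 2 : ℝ)) ≤
      ∫⁻ Y in ball (0 : EuclideanSpace ℝ (Fin 3)) L, ‖⟪β, Y⟫ - cc‖ₑ ^ (3 / 2 : ℝ) := by
    refine (ENNReal.ofReal_le_ofReal hαR).trans (le_of_eq ?_)
    rw [ofReal_integral_eq_lintegral_ofReal hintg (ae_of_all _ fun Y => Real.rpow_nonneg (abs_nonneg _) _)]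
    refine lintegral_congr fun Y => ?_
    rw [Real.enorm_eq_ofReal_abs, ENNReal.ofReal_rpow_of_nonneg (abs_nonneg _) (by norm_num)]
  -- pointwise: `|⟪β,Y⟫ − cc| = |f₁ − f₂|` and convexity
  have hptw : ∀ Y : EuclideanSpace ℝ (Fin 3), ‖⟪β, Y⟫ - cc‖ₑ ^ (3 / 2 : ℝ) ≤
      (2 : ℝ≥0∞) ^ (1 / 2 : ℝ) * (‖Pbar Y - ⟪b τ₁, Y⟫ + c₁ τ₁‖ₑ ^ (3 / 2 : ℝ) +
        ‖Pbar Y - ⟪b τ₂, Y⟫ + c₁ τ₂‖ₑ ^ (3 / 2 : ℝ)) := by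
    intro Y
    have e : ⟪β, Y⟫ - cc = -((Pbar Y - ⟪b τ₁, Y⟫ + c₁ τ₁) - (Pbar Y - ⟪b τ₂, Y⟫ + c₁ τ₂)) := by
      rw [hβdef, hccdef, inner_sub_left]; ring
    rw [e, enorm_neg]
    exact enorm_sub_rpow_threeHalves_le _ _
  have hsum : ∫⁻ Y in ball (0 : EuclideanSpace ℝ (Fin 3)) L, ‖⟪β, Y⟫ - cc‖ₑ ^ (3 / 2 : ℝ) ≤
      (2 : ℝ≥0∞) ^ (1 / 2 : ℝ) * ((∫⁻ Y in ball (0 : EuclideanSpace ℝ (Fin 3)) L,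
          ‖Pbar Y - ⟪b τ₁, Y⟫ + c₁ τ₁‖ₑ ^ (3 / 2 : ℝ)) +
        ∫⁻ Y in ball (0 : EuclideanSpace ℝ (Fin 3)) L, ‖Pbar Y - ⟪b τ₂, Y⟫ + c₁ τ₂‖ₑ ^ (3 / 2 : ℝ)) := by
    refine (lintegral_mono fun Y => hptw Y).trans (le_of_eq ?_)
    rw [lintegral_const_mul' _ _ (ENNReal.rpow_ne_top_of_nonneg (by norm_num) ENNReal.ofNat_ne_top),
      lintegral_add_left' hf₁m.restrict]
  -- ### the final inequality in `ℝ≥0∞`, then in `ℝ`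
  set D : ℝ≥0∞ := ENNReal.ofReal ((c : ℝ) * a ^ (2 - 2 * ρ)) with hDdef
  have hJ₁' : ∫⁻ Y in ball (0 : EuclideanSpace ℝ (Fin 3)) L, ‖Pbar Y - ⟪b τ₁, Y⟫ + c₁ τ₁‖ₑ ^ (3 / 2 : ℝ) ≤
      ENNReal.ofReal S₀ * (D / volume A₁) :=
    hJ₁.trans (mul_le_mul' le_rfl (hτ₁.trans (ENNReal.div_le_div_right htot _)))
  have hJ₂' : ∫⁻ Y in ball (0 : EuclideanSpace ℝ (Fin 3)) L, ‖Pbar Y - ⟪b τ₂, Y⟫ + c₁ τ₂‖ₑ ^ (3 / 2 : ℝ) ≤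
      ENNReal.ofReal S₀ * (D / volume A₂) :=
    hJ₂.trans (mul_le_mul' le_rfl (hτ₂.trans (ENNReal.div_le_div_right htot _)))
  have hfin : ENNReal.ofReal (κ * ‖β‖ ^ (3 / 2 : ℝ) * L ^ (9 / 2 : ℝ)) ≤ ENNReal.ofReal (rhsC * a ^ (2 - 2 * ρ)) := by
    refine hαE.trans (hsum.trans ?_)
    calc (2 : ℝ≥0∞) ^ (1 / 2 : ℝ) * ((∫⁻ Y in ball (0 : EuclideanSpace ℝ (Fin 3)) L,
            ‖Pbar Y - ⟪b τ₁, Y⟫ + c₁ τ₁‖ₑ ^ (3 / 2 : ℝ)) +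
          ∫⁻ Y in ball (0 : EuclideanSpace ℝ (Fin 3)) L, ‖Pbar Y - ⟪b τ₂, Y⟫ + c₁ τ₂‖ₑ ^ (3 / 2 : ℝ))
        ≤ (2 : ℝ≥0∞) ^ (1 / 2 : ℝ) * (ENNReal.ofReal S₀ * (D / volume A₁) + ENNReal.ofReal S₀ * (D / volume A₂)) :=
          mul_le_mul' le_rfl (add_le_add hJ₁' hJ₂')
      _ = ENNReal.ofReal (rhsC * a ^ (2 - 2 * ρ)) := by
          have e1 : ENNReal.ofReal S₀ * (D / volume A₁) + ENNReal.ofReal S₀ * (D / volume A₂) =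
              ENNReal.ofReal S₀ * D * ((volume A₁)⁻¹ + (volume A₂)⁻¹) := by
            rw [ENNReal.div_eq_inv_mul, ENNReal.div_eq_inv_mul]; ring
          have e2 : (2 : ℝ≥0∞) ^ (1 / 2 : ℝ) = ENNReal.ofReal ((2 : ℝ) ^ (1 / 2 : ℝ)) := by
            rw [← ENNReal.ofReal_rpow_of_pos two_pos, ENNReal.ofReal_ofNat]
          have hca : 0 ≤ (c : ℝ) * a ^ (2 - 2 * ρ) := by positivity
          have h2 : 0 ≤ (2 : ℝ) ^ (1 / 2 : ℝ) := Real.rpow_nonneg zero_le_two _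
          rw [e1, hΛ, hDdef, e2, ← ENNReal.ofReal_mul hS₀0.le, ← ENNReal.ofReal_mul (mul_nonneg hS₀0.le hca),
            ← ENNReal.ofReal_mul h2]
          congr 1
          rw [hrhsC]
          ring
  have hra : 0 ≤ rhsC * a ^ (2 - 2 * ρ) := mul_nonneg hrhsC0 (Real.rpow_nonneg ha0.le _)
  have hfinR : κ * ‖β‖ ^ (3 / 2 : ℝ) * L ^ (9 / 2 : ℝ) ≤ rhsC * a ^ (2 - 2 * ρ) :=
    (ENNReal.ofReal_le_ofReal_iff hra).1 hfin
  -- lower bound of the left side by `lhsC · a^{9/2}`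
  have hlow : lhsC * a ^ (9 / 2 : ℝ) ≤ κ * ‖β‖ ^ (3 / 2 : ℝ) * L ^ (9 / 2 : ℝ) := by
    rw [hlhsC, hLdef, Real.mul_rpow (by positivity) ha0.le]
    have h1 : (2 * r) ^ (3 / 2 : ℝ) ≤ ‖β‖ ^ (3 / 2 : ℝ) := Real.rpow_le_rpow (by positivity) hβ (by norm_num)
    have h2 : 0 ≤ (slo / 2) ^ (9 / 2 : ℝ) * a ^ (9 / 2 : ℝ) := by positivity
    calc κ * (2 * r) ^ (3 / 2 : ℝ) * (slo / 2) ^ (9 / 2 : ℝ) * a ^ (9 / 2 : ℝ)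
        = κ * (2 * r) ^ (3 / 2 : ℝ) * ((slo / 2) ^ (9 / 2 : ℝ) * a ^ (9 / 2 : ℝ)) := by ring
      _ ≤ κ * ‖β‖ ^ (3 / 2 : ℝ) * ((slo / 2) ^ (9 / 2 : ℝ) * a ^ (9 / 2 : ℝ)) :=
          mul_le_mul_of_nonneg_right (mul_le_mul_of_nonneg_left h1 hκ.le) h2
  exact absurd (lt_of_le_of_lt (hlow.trans hfinR) ha4) (lt_irrefl _)

end Summit.NavierStokesRegularity.NavierStokesRegularity.Theorems.PowerGaugeEulerLiouville.GalileanFrames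

end
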